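import Literature.MathematicalPhysics.QuantumFieldTheory.WilsonFinTorusTwistedPartition
import Literature.MathematicalPhysics.QuantumFieldTheory.YangMillsOS
import Literature.Analysis.OperatorTheory.TwistedKernelTraceFormula
import Literature.Analysis.OperatorTheory.CompactSelfAdjointEigenbasis
import Mathlib.Analysis.InnerProductSpace.Adjoint
import HarnessLib

/-!
# Centre-adapted spectral data of the slice transfer operator (crux `IRcof` ⟨stmt-QuantumFields-26930⟩, line
# `inplane_squaring_ladder`, registered stub `stub_adaptedSpectralData : AdaptedSpectralData` — the mathematics)

Cell `ym-gapexp` (R2c), helper lane (director-ym R660-ym (1); critic of record `ymfull-r2c-crit-1`, CUT-9 §A «HAND-READY STUB»,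
HELPER-ROUTE `HELPER-ROUTE-adapted.lean` sha16 cd1427fa99c0a313).  Skeleton of record for the line:
`Summits/QuantumFields/YangMills/Cruxes/IRcof/Lines/inplane_squaring_ladder.lean` sha16 2d7939aac1b7e59b (stub TYPE unchanged in v1_1).

WHAT IS PROVED (finite-volume linear algebra ∕ transfer-matrix bookkeeping at ONE box and ONE `β ≥ 0`; def-free):

* §1 (abstract, crit-1's route, kernel-checked there; re-typed here with docstrings) `sign_sorting`, `exists_adapted_eigenbasis` —
  for a compact self-adjoint `A ≥ 0` on a real Hilbert space commuting with a self-adjoint idempotent `P`, ONE diagonalisation of the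
  signed operator `A ∘ (2P − 1)` (tree: `Literature.Analysis.OperatorTheory.exists_hilbertBasis_eigenvectors_of_isSelfAdjoint`) yields a
  Hilbert basis of `A`-eigenvectors `A bᵢ = λᵢ bᵢ`, `λᵢ ≥ 0`, with weights `wᵢ ∈ {0, 1}` and `P bᵢ = wᵢ bᵢ` whenever `λᵢ ≠ 0`.
* §2 (the twist group on `L²` of one time slice) for a central `g` with `g ^ n = 1`, `n = k + 1`: the Koopman isometries `U_e` of the
  central slice twists `T_e = finSliceTwist (update 1 0 (g ^ e))`, `e : Fin n` ('t Hooft's `Ω[k]` on the temporal plane `(0,3)`), satisfy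
  `U_e U_{e'} = U_{e'+e}`, `⟪U_e φ, ψ⟫ = ⟪φ, U_{−e} ψ⟫`, and COMMUTE with the transfer operator `A` of `finTorusSliceKernel ρ β`
  (`finTorusSliceKernel_finSliceTwist`: the twist is an invariance of the kernel; `measurePreserving_finSliceTwist`); hence the flux
  projection `P := n⁻¹ Σ_e U_e` is a self-adjoint idempotent commuting with `A`.
* §3 ★ `adaptedSpectralDataAt` — for `β ≥ 0`, continuous unitary `ρ`, central `g`, `0 < n`, `g ^ n = 1` and every spatial box
  `b₁ × b₂ × b₃`: there are `λᵢ ≥ 0`, `wᵢ ∈ {0,1}` with `Z(b, m+2) = Σᵢ λᵢ^{m+2}` (`hasSum_pow_integral_cyclic`, Montvay–Münster (3.145))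
  and `n⁻¹ Σ_{e<n} Z^{(gᵉ on (0,3))}(b, m+2) = Σᵢ λᵢ^{m+2} wᵢ` ('t Hooft (5.3): `wilsonFinTorusTwistedPartition_eq_integral_iterate` +
  `hasSum_pow_integral_iterate_twisted`, and `n⁻¹ Σ_e ⟪U_e A bᵢ, A bᵢ⟫ = λᵢ² ⟪P bᵢ, bᵢ⟫ = λᵢ² wᵢ`); ★ `adaptedSpectralData` — the same
  packaged over all compact simple `G`, all `LatticeRep`s and all boxes: this is the registered stub type `AdaptedSpectralData` of the line
  with the skeleton-local abbreviations `tw0`, `P0`, `AdaptedSpectralDataAt` δ-unfolded token for token (the by-name inhabitant lives in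
  `IRcofAdaptedSpectralData.lean`, which copies those abbreviations verbatim).

HONEST FRAMING: helper/registry work for R2c.  Nothing here is an estimate in `β` or in the box, nothing on confinement, purity, `IRcof`,
`IR`, or the Yang–Mills mass gap (Clay), which is NOT proved; finite-volume ∕ conditional.

References: G. 't Hooft, Nucl. Phys. B 153 (1979) 141, §4 (4.2)–(4.5), §5 (5.1)–(5.4); M. Lüscher, Commun. Math. Phys. 54 (1977) 283;
I. Montvay, G. Münster, *Quantum Fields on a Lattice* (1994) §3.2.6 (3.145); M. Reed, B. Simon, *Methods of Modern Mathematical Physics* I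
(1980) Thm. VI.16, VI.22–23; J.-P. Serre, *Linear Representations of Finite Groups* (1977) §2.6 Thm 8.
-/

noncomputable section

open scoped BigOperators ENNReal
open MeasureTheory Filter Function
open Literature.Analysis.OperatorTheory Literature.MathematicalPhysics.QuantumFieldTheory

namespace Summit.QuantumFields.YangMills.Theorems.IRcofAdaptedSpectralDataCore

/-! ### §1 Adapted eigenbasis from ONE diagonalisation (crit-1 `HELPER-ROUTE-adapted.lean` cd1427fa99c0a313) -/

section Abstract

variable {E : Type*} [NormedAddCommGroup E] [InnerProductSpace ℝ E] [CompleteSpace E]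

omit [CompleteSpace E] in
/-- **Sign sorting** (crit-1).  `A ≥ 0`, `P` idempotent, `A P = P A`; if `b` is an eigenvector of the signed operator
`C = A ∘ (2P − 1)` with eigenvalue `κ`, then `A b = |κ| b`, and `b ∈ range P` if `κ > 0`, `b ∈ ker P` if `κ < 0`
(positivity of `A` on the two components `P b`, `b − P b`). -/
theorem sign_sorting {A P : E →L[ℝ] E} (hApos : ∀ x, 0 ≤ @inner ℝ E _ (A x) x) (hP2 : ∀ x, P (P x) = P x)
    (hcomm : ∀ x, A (P x) = P (A x)) {b : E} {κ : ℝ} (hb : A ((2 : ℝ) • P b - b) = κ • b) :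
    A b = |κ| • b ∧ (0 < κ → P b = b) ∧ (κ < 0 → P b = 0) := by
  -- adapted from pub/ym-gapexp/ymfull-r2c-crit-1/HELPER-ROUTE-adapted.lean (crit-1 g1)
  have h0 : A (P b) = κ • P b := by
    have := congrArg P hb
    rw [← hcomm, map_sub, map_smul, hP2, map_smul] at this
    have e : (2 : ℝ) • P b - P b = P b := by rw [two_smul]; abel
    rwa [e] at this
  have hAb : A b = κ • P b - κ • (b - P b) := by
    have h := hb
    rw [map_sub, map_smul, h0] at h
    have : A b = (2 : ℝ) • κ • P b - κ • b := by rw [← h]; abel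
    rw [this, smul_sub, two_smul]; abel
  have h1 : A (b - P b) = -κ • (b - P b) := by
    rw [map_sub, hAb, h0, neg_smul, smul_sub]; abel
  have q0 : 0 ≤ κ * ‖P b‖ ^ 2 := by
    have := hApos (P b); rwa [h0, real_inner_smul_left, real_inner_self_eq_norm_sq] at this
  have q1 : 0 ≤ -κ * ‖b - P b‖ ^ 2 := by
    have := hApos (b - P b); rwa [h1, real_inner_smul_left, real_inner_self_eq_norm_sq] at this
  refine ⟨?_, fun hκ => ?_, fun hκ => ?_⟩
  · rcases lt_trichotomy κ 0 with hκ | hκ | hκ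
    · have hn : ‖P b‖ ^ 2 = 0 := by nlinarith [sq_nonneg ‖P b‖]
      have hPb : P b = 0 := by rwa [sq_eq_zero_iff, norm_eq_zero] at hn
      rw [hAb, hPb, smul_zero, zero_sub, sub_zero, abs_of_neg hκ, neg_smul]
    · subst hκ; rw [hAb]; simp
    · have hn : ‖b - P b‖ ^ 2 = 0 := by nlinarith [sq_nonneg ‖b - P b‖]
      have hPb : b - P b = 0 := by rwa [sq_eq_zero_iff, norm_eq_zero] at hn
      rw [hAb, hPb, smul_zero, sub_zero, abs_of_pos hκ]
      rw [sub_eq_zero] at hPb; rw [← hPb]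
  · have hn : ‖b - P b‖ ^ 2 = 0 := by nlinarith [sq_nonneg ‖b - P b‖]
    have hPb : b - P b = 0 := by rwa [sq_eq_zero_iff, norm_eq_zero] at hn
    rw [sub_eq_zero] at hPb; exact hPb.symm
  · have hn : ‖P b‖ ^ 2 = 0 := by nlinarith [sq_nonneg ‖P b‖]
    rwa [sq_eq_zero_iff, norm_eq_zero] at hn

/-- **Adapted eigenbasis from ONE diagonalisation** (crit-1).  `A` compact, self-adjoint, `≥ 0`; `P` a self-adjoint idempotent
commuting with `A`.  Then there is a Hilbert basis of `A`-eigenvectors with eigenvalues `lam i ≥ 0` and weights `w i ∈ {0, 1}` such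
that `P (b i) = w i • b i` whenever `lam i ≠ 0` (diagonalise the compact self-adjoint `A ∘ (2P − 1)` by the tree's Hilbert–Schmidt
theorem `exists_hilbertBasis_eigenvectors_of_isSelfAdjoint`, then `sign_sorting`). [cite: ReedSimonI1980, Thm. VI.16 and Thm. VI.22–23] -/
theorem exists_adapted_eigenbasis {A P : E →L[ℝ] E} (hAc : IsCompactOperator A) (hAsa : IsSelfAdjoint A)
    (hApos : ∀ x, 0 ≤ @inner ℝ E _ (A x) x) (hPsa : IsSelfAdjoint P) (hP2 : ∀ x, P (P x) = P x)
    (hcomm : ∀ x, A (P x) = P (A x)) :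
    ∃ (s : Set E) (b : HilbertBasis s ℝ E) (lam w : s → ℝ),
      ⇑b = ((↑) : s → E) ∧ (∀ i, A (b i) = lam i • b i) ∧ (∀ i, 0 ≤ lam i) ∧ (∀ i, w i = 0 ∨ w i = 1) ∧
      (∀ i, lam i ≠ 0 → P (b i) = w i • b i) := by
  -- adapted from pub/ym-gapexp/ymfull-r2c-crit-1/HELPER-ROUTE-adapted.lean (crit-1 g1)
  set R : E →L[ℝ] E := (2 : ℝ) • P - 1 with hR
  have hRsa : IsSelfAdjoint R := by
    show star R = R
    rw [hR, star_sub, star_smul, star_one, star_trivial, hPsa.star_eq]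
  have hcommR : A.comp R = R.comp A := by
    ext x; simp [hR, hcomm]
  have hCsa : IsSelfAdjoint (A.comp R) := by
    rw [ContinuousLinearMap.isSelfAdjoint_iff'] at hAsa hRsa ⊢
    rw [ContinuousLinearMap.adjoint_comp, hAsa, hRsa, ← hcommR]
  have hCc : IsCompactOperator (A.comp R) := hAc.comp_clm R
  obtain ⟨s, b, κ, hbs, hb⟩ :=
    Literature.Analysis.OperatorTheory.exists_hilbertBasis_eigenvectors_of_isSelfAdjoint hCc hCsa
  have hbi : ∀ i, A ((2 : ℝ) • P (b i) - b i) = κ i • b i := fun i => by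
    have := hb i; simpa [hR] using this
  refine ⟨s, b, fun i => |κ i|, fun i => if 0 < κ i then 1 else 0, hbs, fun i => (sign_sorting hApos hP2 hcomm (hbi i)).1,
    fun i => abs_nonneg _, fun i => ?_, fun i hi => ?_⟩
  · by_cases h : 0 < κ i <;> simp [h]
  · have hs := sign_sorting hApos hP2 hcomm (hbi i)
    have hκ : κ i ≠ 0 := fun h => hi (by simp only [h, abs_zero])
    show P (b i) = (if 0 < κ i then (1 : ℝ) else 0) • b i
    rcases lt_or_gt_of_ne hκ with hlt | hgt
    · rw [if_neg (not_lt.2 hlt.le), zero_smul]; exact hs.2.2 hlt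
    · rw [if_pos hgt, one_smul]; exact hs.2.1 hgt

end Abstract

/-! ### §2 The central slice twists as measurable automorphisms of one time slice -/

section Twist

variable {b₁ b₂ b₃ : ℕ} {G : Type} [Group G] [TopologicalSpace G] [IsTopologicalGroup G] [CompactSpace G]
  [MeasurableSpace G] [BorelSpace G]

/-- The slice twist `T_z` is a measurable automorphism of the slice (inverse `T_{z⁻¹}`), in particular a measurable embedding —
so that `∫ F (T_z x) dμ = ∫ F dμ` holds for EVERY `F` (`MeasurePreserving.integral_comp`). [cite: tHooft1979Flux, §4 (4.2)–(4.4)] -/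
theorem measurableEmbedding_finSliceTwist (z : Fin 4 → G) :
    MeasurableEmbedding (finSliceTwist z :
      (FinSpatialSite b₁ b₂ b₃ × Fin 3 → G) → FinSpatialSite b₁ b₂ b₃ × Fin 3 → G) :=
  (⟨⟨finSliceTwist z, finSliceTwist z⁻¹, fun a => finSliceTwist_inv_finSliceTwist z a,
      fun a => finSliceTwist_finSliceTwist_inv z a⟩,
    (measurePreserving_finSliceTwist (b₁ := b₁) (b₂ := b₂) (b₃ := b₃) z).measurable,
    (measurePreserving_finSliceTwist (b₁ := b₁) (b₂ := b₂) (b₃ := b₃) z⁻¹).measurable⟩ :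
    (FinSpatialSite b₁ b₂ b₃ × Fin 3 → G) ≃ᵐ (FinSpatialSite b₁ b₂ b₃ × Fin 3 → G)).measurableEmbedding

/-- Change of variables under a slice twist: `∫ F (T_z x) ∏ dU = ∫ F ∏ dU` for every `F` (Haar invariance, Montvay–Münster (3.90)).
[cite: MontvayMunster1994, §3.2 (3.90)] -/
theorem integral_comp_finSliceTwist (z : Fin 4 → G) (F : (FinSpatialSite b₁ b₂ b₃ × Fin 3 → G) → ℝ) :
    ∫ x, F (finSliceTwist z x) ∂(Measure.pi fun _ : FinSpatialSite b₁ b₂ b₃ × Fin 3 => haarProbability G) =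
      ∫ x, F x ∂(Measure.pi fun _ : FinSpatialSite b₁ b₂ b₃ × Fin 3 => haarProbability G) :=
  (measurePreserving_finSliceTwist z).integral_comp (measurableEmbedding_finSliceTwist z) F

end Twist

/-! ### §3 The adapted spectral data of one box -/

section Main

variable {G : Type} [Group G] [TopologicalSpace G] [IsTopologicalGroup G] [CompactSpace G]
  [MeasurableSpace G] [BorelSpace G] [SecondCountableTopology G] {N : ℕ} {ρ : G →* Matrix (Fin N) (Fin N) ℂ}

/-- ★ **Centre-adapted spectral data of the slice transfer operator, one box** (`β ≥ 0`, continuous unitary `ρ`, central `g`,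
`0 < n`, `g ^ n = 1`, every spatial box `b₁ × b₂ × b₃`): there are eigenvalues `λᵢ ≥ 0` of the `L²` transfer operator of
`finTorusSliceKernel ρ β` and weights `wᵢ ∈ {0,1}` (the eigenbasis is ADAPTED to the flux projection `P = n⁻¹ Σ_e U_e` of the cyclic group
of central temporal twists `gᵉ` on the plane `(0,3)`: `P bᵢ = wᵢ bᵢ`) with `Z(b, m+2) = Σᵢ λᵢ^{m+2}` (Montvay–Münster (3.145)) and
`n⁻¹ Σ_{e<n} Z^{(gᵉ on (0,3))}(b, m+2) = Σᵢ λᵢ^{m+2} wᵢ` ('t Hooft (5.3) `Tr P e^{−βH}` in the adapted eigenbasis).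
[cite: tHooft1979Flux, §5 (5.1)–(5.4)] [cite: MontvayMunster1994, §3.2.6 (3.145)] [cite: ReedSimonI1980, Thm. VI.16 and Thm. VI.22–23] -/
theorem adaptedSpectralDataAt (hρ : Continuous ρ) (hρu : ∀ x, ρ x ∈ Matrix.unitaryGroup (Fin N) ℂ) {β : ℝ} (hβ : 0 ≤ β)
    {g : G} (hg : g ∈ Subgroup.center G) {n : ℕ} (hn : 0 < n) (hgn : g ^ n = 1) (b₁ b₂ b₃ : ℕ) :
    ∃ (ι : Type) (lam w : ι → ℝ), (∀ i, 0 ≤ lam i) ∧ (∀ i, w i = 0 ∨ w i = 1) ∧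
      (∀ m : ℕ, HasSum (fun i => lam i ^ (m + 2)) (wilsonFinTorusPartition ρ β b₁ b₂ b₃ (m + 2))) ∧
      (∀ m : ℕ, HasSum (fun i => lam i ^ (m + 2) * w i)
        ((n : ℝ)⁻¹ * ∑ e : Fin n,
          wilsonFinTorusTwistedPartition ρ β (Function.update (1 : Fin 4 → G) 0 (g ^ (e : ℕ))) b₁ b₂ b₃ (m + 2))) := by
  obtain ⟨k, rfl⟩ : ∃ k, n = k + 1 := ⟨n - 1, by omega⟩
  -- the slice, its Haar measure, the slice kernel and its transfer operator
  set μ : Measure (FinSpatialSite b₁ b₂ b₃ × Fin 3 → G) :=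
    Measure.pi fun _ : FinSpatialSite b₁ b₂ b₃ × Fin 3 => haarProbability G with hμ
  set K : (FinSpatialSite b₁ b₂ b₃ × Fin 3 → G) → (FinSpatialSite b₁ b₂ b₃ × Fin 3 → G) → ℝ :=
    finTorusSliceKernel ρ β with hKdef
  have hK : StronglyMeasurable (uncurry K) := stronglyMeasurable_uncurry_finTorusSliceKernel ρ hρ β
  obtain ⟨C, hC⟩ := exists_norm_finTorusSliceKernel_le (b₁ := b₁) (b₂ := b₂) (b₃ := b₃) ρ hρ β
  have hsymm : ∀ x y, K x y = K y x := finTorusSliceKernel_symm ρ hρu β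
  obtain ⟨A, hA⟩ := exists_kernelOp (μ := μ) hK hC
  have hsa : IsSelfAdjoint A := isSelfAdjoint_kernelOp hK hC hsymm hA
  have hC0 : 0 ≤ C := (norm_nonneg _).trans (hC 1 1)
  have hcpt : IsCompactOperator A := isCompactOperator_kernelOp hC hC0 hA
  have hApos : ∀ φ : Lp ℝ 2 μ, 0 ≤ @inner ℝ _ _ (A φ) φ := fun φ => by
    rw [real_inner_comm]
    exact inner_kernelOp_self_nonneg hA (posType_finTorusSliceKernel ρ hρ hρu hβ) φ
  -- the cyclic family of central temporal twists `gᵉ on (0,3)` and the slice twists `T e`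
  set z : Fin (k + 1) → Fin 4 → G := fun e => Function.update (1 : Fin 4 → G) 0 (g ^ (e : ℕ)) with hz
  have hzc : ∀ (e : Fin (k + 1)) (i : Fin 3), z e i.castSucc ∈ Subgroup.center G := by
    intro e i
    by_cases hi : i.castSucc = 0
    · rw [hz]; dsimp only; rw [hi, Function.update_self]; exact Subgroup.pow_mem _ hg _
    · rw [hz]; dsimp only; rw [Function.update_of_ne hi]; exact Subgroup.one_mem _
  have hzmul : ∀ e e' : Fin (k + 1), z e * z e' = z (e + e') := by
    intro e e'
    show (Pi.mulSingle (M := fun _ : Fin 4 => G) 0 (g ^ (e : ℕ))) * Pi.mulSingle (M := fun _ : Fin 4 => G) 0 (g ^ (e' : ℕ)) =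
      Pi.mulSingle (M := fun _ : Fin 4 => G) 0 (g ^ ((e + e' : Fin (k + 1)) : ℕ))
    rw [← Pi.mulSingle_mul, ← pow_add, Fin.val_add, ← pow_eq_pow_mod _ hgn]
  have hz0 : z 0 = 1 := by
    show Pi.mulSingle (M := fun _ : Fin 4 => G) 0 (g ^ ((0 : Fin (k + 1)) : ℕ)) = 1
    rw [Fin.val_zero, pow_zero, Pi.mulSingle_one]
  set T : Fin (k + 1) → (FinSpatialSite b₁ b₂ b₃ × Fin 3 → G) → (FinSpatialSite b₁ b₂ b₃ × Fin 3 → G) :=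
    fun e => finSliceTwist (z e) with hT
  have hTmp : ∀ e, MeasurePreserving (T e) μ μ := fun e => measurePreserving_finSliceTwist (z e)
  have hTT : ∀ e e' x, T e (T e' x) = T (e + e') x := fun e e' x => by
    simp only [hT, finSliceTwist_finSliceTwist, hzmul]
  have hT0 : ∀ x, T 0 x = x := fun x => by
    simp only [hT, hz0, finSliceTwist_one, id]
  have hTinv : ∀ e x, T e (T (-e) x) = x := fun e x => by rw [hTT, add_neg_cancel, hT0]
  have hTinv' : ∀ e x, T (-e) (T e x) = x := fun e x => by rw [hTT, neg_add_cancel, hT0]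
  have hKT : ∀ e x y, K (T e x) (T e y) = K x y := fun e x y => finTorusSliceKernel_finSliceTwist ρ (hzc e) β x y
  have hcov : ∀ (e) (F : (FinSpatialSite b₁ b₂ b₃ × Fin 3 → G) → ℝ), ∫ x, F (T e x) ∂μ = ∫ x, F x ∂μ :=
    fun e F => integral_comp_finSliceTwist (z e) F
  -- the Koopman isometries `U e φ = φ ∘ T e` and the flux projection `P = n⁻¹ Σ_e U e`
  set U : Fin (k + 1) → (Lp ℝ 2 μ →L[ℝ] Lp ℝ 2 μ) :=
    fun e => (Lp.compMeasurePreservingₗᵢ ℝ (T e) (hTmp e)).toContinuousLinearMap with hU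
  have hUae : ∀ (e) (φ : Lp ℝ 2 μ), (U e φ : (FinSpatialSite b₁ b₂ b₃ × Fin 3 → G) → ℝ) =ᵐ[μ] fun x => φ (T e x) :=
    fun e φ => Lp.coeFn_compMeasurePreserving φ (hTmp e)
  have hUU : ∀ (e e') (φ : Lp ℝ 2 μ), U e (U e' φ) = U (e' + e) φ := by
    intro e e' φ
    refine Lp.ext ?_
    filter_upwards [hUae e (U e' φ), (hTmp e).quasiMeasurePreserving.ae_eq_comp (hUae e' φ), hUae (e' + e) φ]
      with x h1 h2 h3
    rw [h1, h3]
    have h2' : (U e' φ) (T e x) = φ (T e' (T e x)) := h2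
    rw [h2', hTT]
  have hUadj : ∀ (e) (φ ψ : Lp ℝ 2 μ), @inner ℝ _ _ (U e φ) ψ = @inner ℝ _ _ φ (U (-e) ψ) := by
    intro e φ ψ
    rw [inner_eq_integral, inner_eq_integral]
    have h1 : ∫ x, (U e φ) x * ψ x ∂μ = ∫ x, φ (T e x) * ψ x ∂μ :=
      integral_congr_ae (by filter_upwards [hUae e φ] with x hx; rw [hx])
    have h2 : ∫ x, φ x * (U (-e) ψ) x ∂μ = ∫ x, φ x * ψ (T (-e) x) ∂μ :=
      integral_congr_ae (by filter_upwards [hUae (-e) ψ] with x hx; rw [hx])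
    rw [h1, h2, ← hcov e (fun x => φ x * ψ (T (-e) x))]
    refine integral_congr_ae (Eventually.of_forall fun x => ?_)
    simp only [hTinv']
  have hAU : ∀ (e) (φ : Lp ℝ 2 μ), A (U e φ) = U e (A φ) := by
    intro e φ
    refine Lp.ext ?_
    have h3 : ∀ x, ∫ y, K x y * (U e φ) y ∂μ = ∫ y, K (T e x) y * φ y ∂μ := by
      intro x
      have h1 : ∫ y, K x y * (U e φ) y ∂μ = ∫ y, K x y * φ (T e y) ∂μ :=
        integral_congr_ae (by filter_upwards [hUae e φ] with y hy; rw [hy])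
      rw [h1, ← hcov (-e) (fun y => K x y * φ (T e y))]
      refine integral_congr_ae (Eventually.of_forall fun y => ?_)
      simp only
      rw [hTinv, ← hKT e x (T (-e) y), hTinv]
    filter_upwards [hA (U e φ), hUae e (A φ), (hTmp e).quasiMeasurePreserving.ae_eq_comp (hA φ)] with x h1 h2 h4
    rw [h1, h3 x, h2]
    exact h4.symm
  set P : Lp ℝ 2 μ →L[ℝ] Lp ℝ 2 μ := ((k + 1 : ℕ) : ℝ)⁻¹ • ∑ e, U e with hP
  have hPapply : ∀ φ : Lp ℝ 2 μ, P φ = ((k + 1 : ℕ) : ℝ)⁻¹ • ∑ e, U e φ := fun φ => by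
    simp only [hP, smul_apply, sum_apply]
  have hn' : ((k + 1 : ℕ) : ℝ) ≠ 0 := by positivity
  have hP2 : ∀ φ, P (P φ) = P φ := by
    intro φ
    have hsumU : ∀ e, ∑ e', U e (U e' φ) = ∑ e'', U e'' φ := fun e => by
      simp_rw [hUU]
      exact Fintype.sum_equiv (Equiv.addRight e) _ _ fun e' => rfl
    rw [hPapply (P φ), hPapply φ]
    simp_rw [map_smul, map_sum, hsumU, Finset.sum_const, Finset.card_univ, Fintype.card_fin, ← Nat.cast_smul_eq_nsmul ℝ,
      smul_smul]
    rw [inv_mul_cancel_left₀ hn']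
  have hPsym : ∀ φ ψ : Lp ℝ 2 μ, @inner ℝ _ _ (P φ) ψ = @inner ℝ _ _ φ (P ψ) := by
    intro φ ψ
    rw [hPapply, hPapply, real_inner_smul_left, real_inner_smul_right, sum_inner, inner_sum]
    congr 1
    simp_rw [hUadj]
    exact Fintype.sum_equiv (Equiv.neg (Fin (k + 1))) _ _ fun e => rfl
  have hPsa : IsSelfAdjoint P := by
    rw [ContinuousLinearMap.isSelfAdjoint_iff_isSymmetric]
    intro φ ψ
    exact hPsym φ ψ
  have hcomm : ∀ φ, A (P φ) = P (A φ) := fun φ => by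
    rw [hPapply, hPapply, map_smul, map_sum]
    simp_rw [hAU]
  -- ONE diagonalisation, adapted to `P`
  obtain ⟨s, bb, lam, w, hbs, hb, hlam0, hw, hPb⟩ := exists_adapted_eigenbasis hcpt hsa hApos hPsa hP2 hcomm
  haveI : Fact ((2 : ℝ≥0∞) ≠ ⊤) := ⟨ENNReal.ofNat_ne_top⟩
  have hon : Orthonormal ℝ ((↑) : s → Lp ℝ 2 μ) := hbs ▸ bb.orthonormal
  haveI : Countable s := (hon.countable_of_separableSpace (𝕜 := ℝ)).to_subtype
  -- the flux weight of an eigenvector: `n⁻¹ Σ_e ⟪U_e A bᵢ, A bᵢ⟫ = λᵢ² wᵢ`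
  have hg : ∀ e i, ∫ x, (∫ y, K (T e x) y * bb i y ∂μ) * (∫ y, K x y * bb i y ∂μ) ∂μ =
      lam i * lam i * @inner ℝ _ _ (U e (bb i)) (bb i) := by
    intro e i
    have h1 : @inner ℝ _ _ (U e (A (bb i))) (A (bb i)) =
        ∫ x, (∫ y, K (T e x) y * bb i y ∂μ) * (∫ y, K x y * bb i y ∂μ) ∂μ := by
      rw [inner_eq_integral]
      refine integral_congr_ae ?_
      filter_upwards [hUae e (A (bb i)), (hTmp e).quasiMeasurePreserving.ae_eq_comp (hA (bb i)), hA (bb i)]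
        with x h1 h2 h3
      rw [h1, h3]
      have h2' : (A (bb i)) (T e x) = ∫ y, K (T e x) y * bb i y ∂μ := h2
      rw [h2']
    rw [← h1, hb i, map_smul, real_inner_smul_left, real_inner_smul_right, mul_assoc]
  have hflux : ∀ (m : ℕ) (i : s), ((k + 1 : ℕ) : ℝ)⁻¹ * ∑ e, lam i ^ m *
      ∫ x, (∫ y, K (T e x) y * bb i y ∂μ) * (∫ y, K x y * bb i y ∂μ) ∂μ = lam i ^ (m + 2) * w i := by
    intro m i
    simp_rw [hg]
    have h1 : ((k + 1 : ℕ) : ℝ)⁻¹ * ∑ e, lam i ^ m * (lam i * lam i * @inner ℝ _ _ (U e (bb i)) (bb i)) =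
        lam i ^ (m + 2) * @inner ℝ _ _ (P (bb i)) (bb i) := by
      rw [hPapply, real_inner_smul_left, sum_inner, Finset.mul_sum, Finset.mul_sum, Finset.mul_sum]
      exact Finset.sum_congr rfl fun e _ => by ring
    rw [h1]
    rcases eq_or_ne (lam i) 0 with h0 | h0
    · rw [h0, zero_pow (Nat.succ_ne_zero _), zero_mul, zero_mul]
    · rw [hPb i h0, real_inner_smul_left, real_inner_self_eq_norm_sq, bb.orthonormal.norm_eq_one i, one_pow, mul_one]
  refine ⟨s, lam, w, hlam0, hw, fun m => ?_, fun m => ?_⟩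
  · -- `Z(b, m+2) = Σ λᵢ^{m+2}` (Montvay–Münster (3.145))
    rw [wilsonFinTorusPartition_eq_integral_prod_finTorusSliceKernel_succ ρ hρ β b₁ b₂ b₃ m]
    exact hasSum_pow_integral_cyclic hK hC hsymm hA hb hlam0 m
  · -- `n⁻¹ Σ_e Z^{(gᵉ)}(b, m+2) = Σ λᵢ^{m+2} wᵢ` ('t Hooft (5.3) in the adapted eigenbasis)
    have he : ∀ e : Fin (k + 1), HasSum (fun i : s => lam i ^ m *
        ∫ x, (∫ y, K (T e x) y * bb i y ∂μ) * (∫ y, K x y * bb i y ∂μ) ∂μ)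
        (wilsonFinTorusTwistedPartition ρ β (z e) b₁ b₂ b₃ (m + 2)) := fun e => by
      rw [wilsonFinTorusTwistedPartition_eq_integral_iterate ρ hρ β (hzc e) b₁ b₂ b₃ m]
      exact hasSum_pow_integral_iterate_twisted hK hC hsymm hA hb (hTmp e).measurable m
    have hs := (hasSum_sum fun e (_ : e ∈ (Finset.univ : Finset (Fin (k + 1)))) => he e).mul_left
      (((k + 1 : ℕ) : ℝ)⁻¹)
    refine hs.congr_fun fun i => ?_
    exact (hflux m i).symm

/-- ★★ **The registered stub type `AdaptedSpectralData` of line `inplane_squaring_ladder` (skeleton 2d7939aac1b7e59b), with the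
skeleton-local abbreviations `tw0 g = update 1 0 g`, `P0 = n⁻¹ Σ_{e<n} Z^{(tw0 (g^e))}`, `AdaptedSpectralDataAt` δ-UNFOLDED token
for token**: for every compact simple `G`, every `LatticeRep`, `β ≥ 0`, central `g` with `g ^ n = 1`, `0 < n`, and every box
`a × b × c` (`a, b, c ≥ 1`), the centre-adapted spectral data exist.  The by-name inhabitant `stub_adaptedSpectralData : AdaptedSpectralData`
is `IRcofAdaptedSpectralData.lean`. [cite: tHooft1979Flux, §5 (5.1)–(5.4)] [cite: MontvayMunster1994, §3.2.6 (3.145)] -/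
theorem adaptedSpectralData :
    ∀ (G : Type) [Group G] [TopologicalSpace G] [IsTopologicalGroup G] [CompactSpace G],
      IsCompactSimpleLieGroup G → SimplyConnectedSpace G →
      letI : MeasurableSpace G := borel G
      haveI : BorelSpace G := ⟨rfl⟩
      ∀ (r : LatticeRep G) (β : ℝ), 0 ≤ β → ∀ g ∈ Subgroup.center G, ∀ n : ℕ, 0 < n → g ^ n = 1 →
        ∀ a b c : ℕ, 1 ≤ a → 1 ≤ b → 1 ≤ c →
          ∃ (ι : Type) (lam w : ι → ℝ), (∀ i, 0 ≤ lam i) ∧ (∀ i, w i = 0 ∨ w i = 1) ∧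
            (∀ m : ℕ, HasSum (fun i => lam i ^ (m + 2)) (wilsonFinTorusPartition r.ρ β a b c (m + 2))) ∧
            (∀ m : ℕ, HasSum (fun i => lam i ^ (m + 2) * w i)
              ((n : ℝ)⁻¹ * ∑ e : Fin n,
                wilsonFinTorusTwistedPartition r.ρ β (Function.update (1 : Fin 4 → G) 0 (g ^ (e : ℕ))) a b c (m + 2))) := by
  intro G _ _ _ _ _ _
  letI : MeasurableSpace G := borel G
  haveI : BorelSpace G := ⟨rfl⟩
  intro r β hβ g hg n hn hgn a b c _ _ _
  haveI : SecondCountableTopology G :=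
    (r.continuous.isClosedEmbedding r.injective).isEmbedding.secondCountableTopology
  exact adaptedSpectralDataAt r.continuous r.mem_unitary hβ hg hn hgn a b c

end Main

end Summit.QuantumFields.YangMills.Theorems.IRcofAdaptedSpectralDataCore

end
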